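import Summits.BirchSwinnertonDyer.BirchSwinnertonDyer.Theorems.GenusKolyvaginAtTwoGenusPrimitiveSupplyAtTwoDescentSignIffSha
import HarnessLib

/-!
# Route `GenusKolyvaginAtTwo`, residual `OffCutResidualAtTwoR` (stmt-BirchSwinnertonDyer-31767) / crux #2 `GenusPrimitiveSupplyAtTwo`:
# EXACT DESCENT AND KRAMER'S INVARIANT PART ALONG AN IMAGINARY QUADRATIC FIELD WITH `2` INERT
# (`F1Sign2.DescAdmissibleUnram`: `d ≡ 5 (mod 8)`, `E` good at `2`), and the class-free forms `DescAdmissible ∨ DescAdmissibleUnram`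

Width seat `bsd-line-gk2-p5` g38 (cell `bsd-f1-sign2`), sequel of this lineage's files 49 (`…AdmissibleExactDescent`, exact descent for
`d ≡ 1 (mod 8)`) and 50 (`…DescentSignIffSha` §209: Kramer's invariant part `Sel₂(E_K/K)^{Gal(K/ℚ)} = res_K Sel₂^{rel ∞}(W)`), and of
`…PrimeTwistUnramifiedTwo` (the prime-twist dictionary at an inert `2`).  THEOREMS ONLY (no definition, no named fact, no `sorry`); helper
`--supports stmt-BirchSwinnertonDyer-31767`; no item is closed; **BSD is NOT proved by any of this.**

WHY.  The K₄⁺-cell theorems of `…PosDiscShallowKFourPosCell*` and LEAD's LINE 27 S2 (SOC) file carry the clause «`2` split in `K`» only because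
file 49's exact descent and file 50's invariant-part theorem ask `F1Sign2.DescAdmissible W d` (`d ≡ 1 (mod 8)`).  On a Heegner frame with ODD `d_K`
the other case is `2` INERT, `2 ∤ N`: `d_K ≡ 5 (mod 8)` and `E` good at `2`, i.e. `F1Sign2.DescAdmissibleUnram`.  In file 49's place-by-place proof
the residue class of `d` mod `8` is used at ONE spot — a BAD prime `2` must split — which is vacuous when `E` is good at `2` (then `2 ∤ d` is an
unramified good prime and gk2-p3's `selmerLocalKer_adicCompletion_eq_of_not_dvd_discr` applies, as at every other unramified good prime).  So:

* §V1 `mem_selmerGroupRelaxedAtInfinityAtTwo_of_forall_mem_selmerLocalKer_of_unram`, `…_of_resTorsion_mem_selmerGroup_of_unram`,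
  `resTorsion_mem_selmerGroup_iff_mem_selmerGroupRelaxedAtInfinityAtTwo_of_unram` — exact descent for `DescAdmissibleUnram`;
  and the CLASS-FREE forms `…_of_descAdmissible_or_unram` (hypothesis `DescAdmissible W d ∨ DescAdmissibleUnram W d`).
* §V2 **`mem_selmerGroup_and_conjAct_eq_iff_exists_mem_relaxed_of_descAdmissible_or_unram`** — Kramer's invariant part, class-free:
  `m ∈ Sel₂(E_K/K)` is `σ₀`-invariant iff `m = res_K x` with `x ∈ Sel₂^{rel ∞}(W)`; and the count `#Sel₂(E_K/K)^{σ₀} = #Sel₂^{rel ∞}(W)`.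

Honest framing: Kramer 1981 Thm. 1 (proof) / Dokchitser–Dokchitser Lemma 4.14 bookkeeping; KNOWN in print; kernel-new; beyond-print theorem: no.
What it buys: the sequel files re-thread gk2-p5's K₄⁺-cell capitulation package and LEAD's S2 (SOC) without «`2` split in `K`».
BSD is NOT proved by any of this; `OffCutResidualAtTwoR`, K4Pos and crux 25504 stay OPEN.

References: [Kramer1981] §2 Prop. 3, Thm. 1; [MilneADT2006] I Cor. 2.3, Thm. 2.8, Prop. 3.8; [DokchitserDokchitserAnnals2010] Lemma 4.14 (proof);
[GrossLMS1991] §5 (5.1); [SerreGaloisCohomology1997] I §2.4.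
-/

set_option linter.dupNamespace false -- tree convention: `Summit.BirchSwinnertonDyer.BirchSwinnertonDyer.Theorems` (summit = sub-problem)
set_option autoImplicit false

noncomputable section

open scoped Classical

namespace Summit.BirchSwinnertonDyer.BirchSwinnertonDyer.Theorems.GenusKolyArch

open WeierstrassCurve NumberField IsDedekindDomain Field
open Literature.NumberTheory.EllipticCurves Literature.NumberTheory.GaloisRepresentations
open Literature.Barriers.BirchSwinnertonDyer (Matsuno2009.primePlace)
open Summit.BirchSwinnertonDyer.Rank1Residual.F1Sign2 (selmerGroupRelaxedAtInfinityAtTwo DescAdmissible DescAdmissibleUnram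
  NoRationalTwoTorsion)
open Rat.HeightOneSpectrum (primesEquiv)

variable (W : WeierstrassCurve ℚ) [W.IsElliptic] [W.IsGloballyMinimal] (K : Type) [Field K] [NumberField K]

/-! ## §V1 Exact descent along `K = ℚ(√d)`, `d` unramified-admissible -/

/-- **Exact descent of the finite `2`-Selmer conditions along an UNRAMIFIED-admissible imaginary quadratic field.**  `W/ℚ` globally minimal,
`d` with `F1Sign2.DescAdmissibleUnram W d` (`d ≡ 5 (mod 8)`, `W` good at `2`), `K ∋ √d` quadratic, `x ∈ H¹(ℚ, E[2])` dying in `H¹(K_w, E)` for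
EVERY finite place `w` of `K` ⟹ `x ∈ Sel₂^{rel ∞}(W)`.  Place by place as in file 49: `p ∣ d` odd, good, silent ⟹ `H¹(ℚ_p, E[2]) = 0`; `p ∤ d`
good (this now includes `p = 2`) is unramified in `K` (`d_K = d` odd) ⟹ the `K_w`- and `ℚ_p`-conditions coincide; `p ∤ d` bad is ODD (`W` is
good at `2`) and splits (`(d/p) = 1`). [cite: Kramer1981, Thm. 1 (proof), Prop. 3] [cite: MilneADT2006, Ch. I Prop. 3.8]
[cite: DokchitserDokchitserAnnals2010, Lemma 4.14 (proof)] -/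
theorem mem_selmerGroupRelaxedAtInfinityAtTwo_of_forall_mem_selmerLocalKer_of_unram {d : ℤ} (hd : DescAdmissibleUnram W d)
    (h2 : Module.finrank ℚ K = 2) {i : K} (hi : i ^ 2 = (d : K)) {x : galH1Torsion W ((2 : ℕ) : ℤ)}
    (hx : ∀ w : HeightOneSpectrum (𝓞 K), x ∈ selmerLocalKer W (w.adicCompletion K) ((2 : ℕ) : ℤ)) :
    x ∈ selmerGroupRelaxedAtInfinityAtTwo W := by
  obtain ⟨hdneg, hsf, hd8, hgood2, hprimes, hbad⟩ := hd
  -- `d_K = d`, odd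
  have hdK : NumberField.discr K = d :=
    Literature.NumberTheory.QuadraticFields.Quadratic.discr_eq_of_sq_eq_intCast_of_neg h2 hi hdneg (by omega) hsf
  have hodd : Odd (NumberField.discr K) := by
    rw [hdK, Int.odd_iff]; omega
  refine AddSubgroup.mem_iInf.mpr fun v ↦ ?_
  obtain ⟨p, hp, rfl⟩ := exists_eq_primePlace v
  haveI := Fact.mk hp
  obtain ⟨w, hw⟩ := Literature.Barriers.BirchSwinnertonDyer.exists_heightOneSpectrum_liesOver K p
  haveI := hw
  have hpv : (p : 𝓞 ℚ) ∈ (Matsuno2009.primePlace p).asIdeal := Literature.Barriers.BirchSwinnertonDyer.Matsuno2009.natCast_mem_primePlace hp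
  by_cases hpd : (p : ℤ) ∣ d
  · -- a prime of `d`: odd, good, silent
    obtain ⟨hgood, hoddap⟩ := hprimes p hp hpd
    have hp2 : p ≠ 2 := by
      rintro rfl
      have : (2 : ℤ) ∣ d := hpd
      omega
    have hgood' : W.HasGoodReductionAtPrime p := hgood inferInstance
    have hpΔ : ¬ (p : ℤ) ∣ minimalDiscriminantInt W := W.not_dvd_minimalDiscriminantInt_of_hasGoodReductionAtPrime' _ hgood'
    have hsil := (GenusKolyTwin.silent_iff_odd_frobeniusTrace W hp2 hpΔ).mpr hoddap
    have h2v : ((2 : ℕ) : 𝓞 ℚ) ∉ (Matsuno2009.primePlace p).asIdeal :=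
      GenusKolyTwistingPrime.natCast_not_mem_of_not_dvd hp hpv fun h ↦
        hp2 ((Nat.prime_dvd_prime_iff_eq hp Nat.prime_two).mp h)
    have hker : Nat.card (nsmulAddMonoidHom 2 :
        (W.baseChange ((Matsuno2009.primePlace p).adicCompletion ℚ)).toAffine.Point →+ _).ker = 1 := by
      rw [natCard_ker_nsmul_adicCompletion_eq_padic W hpv 2]
      have h0 := GenusKolyTwin.twoTorsion_padic_eq_zero_of_forall_ne W hp2 hpΔ hsil
      rw [Nat.card_eq_one_iff_unique]
      refine ⟨⟨fun a b ↦ Subtype.ext ((h0 a.1 a.2).trans (h0 b.1 b.2).symm)⟩, ⟨⟨0, by simp⟩⟩⟩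
    exact mem_selmerLocalKer_of_natCard_ker_eq_one W _ h2v hker x
  · have hpdisc : ¬ (p : ℤ) ∣ NumberField.discr K := by rwa [hdK]
    by_cases hgood : W.HasGoodReductionAt (Matsuno2009.primePlace p)
    · -- unramified good (in particular `p = 2`): the conditions coincide
      rw [← GenusExact.PlusDescent.selmerLocalKer_adicCompletion_eq_of_not_dvd_discr W K w h2 hodd hp hpdisc hgood]
      exact hx w
    · -- bad, hence ODD (good at `2`) and split
      have hbad' : ∀ _h : Fact p.Prime, ¬ W.HasGoodReductionAtPrime p := fun _ hg ↦ by
        have h1 : ¬ p ∣ W.conductorNorm ℤ := not_dvd_conductorNorm_of_hasGoodReductionAtPrime W hg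
        have h2' : (primesEquiv (Matsuno2009.primePlace p) : ℕ) ∣ W.conductorNorm ℤ := (W.dvd_conductorNorm_iff _).mpr hgood
        rw [Literature.Barriers.BirchSwinnertonDyer.Matsuno2009.primesEquiv_primePlace hp] at h2'
        exact h1 h2'
      have hp2 : p ≠ 2 := by
        rintro rfl
        exact hbad' inferInstance (hgood2 inferInstance)
      have hsplit : ((Ideal.span {(p : ℤ)}).primesOver (𝓞 K)).ncard = 2 := by
        rw [Literature.NumberTheory.QuadraticFields.Quadratic.ncard_primesOver_eq_two_iff_jacobiSym h2 hp hp2, hdK]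
        exact hbad p hp hp2 hbad'
      rw [← GenusExact.PlusDescent.selmerLocalKer_adicCompletion_eq_of_ncard_primesOver_eq_two W K w h2 hp hsplit]
      exact hx w

/-- **`res_K x ∈ Sel₂(E_K/K) ⟹ x ∈ Sel₂^{rel ∞}(W)`** for `K ∋ √d`, `d` unramified-admissible. [cite: Kramer1981, Thm. 1 (proof)]
[cite: DokchitserDokchitserAnnals2010, Lemma 4.14 (proof)] -/
theorem mem_selmerGroupRelaxedAtInfinityAtTwo_of_resTorsion_mem_selmerGroup_of_unram {d : ℤ} (hd : DescAdmissibleUnram W d)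
    (h2 : Module.finrank ℚ K = 2) {i : K} (hi : i ^ 2 = (d : K)) {x : galH1Torsion W ((2 : ℕ) : ℤ)}
    (hx : resTorsion W K ((2 : ℕ) : ℤ) x ∈ selmerGroup (W.baseChange K) ((2 : ℕ) : ℤ)) :
    x ∈ selmerGroupRelaxedAtInfinityAtTwo W :=
  mem_selmerGroupRelaxedAtInfinityAtTwo_of_forall_mem_selmerLocalKer_of_unram W K hd h2 hi
    (forall_mem_selmerLocalKer_adicCompletion_of_resTorsion_mem_selmerGroup W K _ hx)

/-- **CLASS-FREE exact descent: `res_K x ∈ Sel₂(E_K/K) ⟹ x ∈ Sel₂^{rel ∞}(W)`** for `K ∋ √d` with `DescAdmissible W d ∨ DescAdmissibleUnram W d`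
(file 49 / §V1). [cite: Kramer1981, Thm. 1 (proof)] -/
theorem mem_selmerGroupRelaxedAtInfinityAtTwo_of_resTorsion_mem_selmerGroup_of_descAdmissible_or_unram {d : ℤ}
    (hd : DescAdmissible W d ∨ DescAdmissibleUnram W d) (h2 : Module.finrank ℚ K = 2) {i : K} (hi : i ^ 2 = (d : K))
    {x : galH1Torsion W ((2 : ℕ) : ℤ)} (hx : resTorsion W K ((2 : ℕ) : ℤ) x ∈ selmerGroup (W.baseChange K) ((2 : ℕ) : ℤ)) :
    x ∈ selmerGroupRelaxedAtInfinityAtTwo W := by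
  rcases hd with hd | hd
  · exact mem_selmerGroupRelaxedAtInfinityAtTwo_of_resTorsion_mem_selmerGroup W K hd h2 hi hx
  · exact mem_selmerGroupRelaxedAtInfinityAtTwo_of_resTorsion_mem_selmerGroup_of_unram W K hd h2 hi hx

omit [W.IsElliptic] in
/-- The sign of `d` from either admissibility class. [folklore] -/
theorem neg_of_descAdmissible_or_unram {d : ℤ} (hd : DescAdmissible W d ∨ DescAdmissibleUnram W d) : d < 0 := by
  rcases hd with hd | hd
  · exact hd.1
  · exact hd.1

/-- **`res_K⁻¹ Sel₂(E_K/K) = Sel₂^{rel ∞}(W)`, CLASS-FREE** (`K ∋ √d`, `DescAdmissible W d ∨ DescAdmissibleUnram W d`): a class of `H¹(ℚ, E[2])`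
restricts into the `2`-Selmer group of `E` over `K` iff it satisfies `W`'s Kummer conditions at all FINITE places (`⇐`: file 47 §200, `K` totally
complex). [cite: Kramer1981, Thm. 1 (proof)] -/
theorem resTorsion_mem_selmerGroup_iff_mem_selmerGroupRelaxedAtInfinityAtTwo_of_descAdmissible_or_unram {d : ℤ}
    (hd : DescAdmissible W d ∨ DescAdmissibleUnram W d) (h2 : Module.finrank ℚ K = 2) {i : K} (hi : i ^ 2 = (d : K))
    (x : galH1Torsion W ((2 : ℕ) : ℤ)) :
    resTorsion W K ((2 : ℕ) : ℤ) x ∈ (W.baseChange K).selmerGroup ((2 : ℕ) : ℤ) ↔ x ∈ selmerGroupRelaxedAtInfinityAtTwo W := by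
  refine ⟨mem_selmerGroupRelaxedAtInfinityAtTwo_of_resTorsion_mem_selmerGroup_of_descAdmissible_or_unram W K hd h2 hi, fun hx ↦ ?_⟩
  rw [selmerGroup_eq_comap_sha, AddSubgroup.mem_comap, torsionH1ToH1_resTorsion]
  exact resBaseChange_torsionH1ToH1_mem_sha_of_mem_relaxed W K
    (infinitePlace_isComplex_of_sq_eq_intCast hi (neg_of_descAdmissible_or_unram W hd)) hx

/-! ## §V2 Kramer's invariant part, class-free -/

/-- **`Sel₂(E_K/K)^{Gal(K/ℚ)} = res_K Sel₂^{rel ∞}(W)`, CLASS-FREE** (Kramer 1981 Thm. 1, the invariant part, finiteness-free): for `W/ℚ` globally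
minimal with `E(ℚ)[2] = 0`, `d` with `DescAdmissible W d ∨ DescAdmissibleUnram W d`, `K ∋ √d` quadratic and ANY non-trivial `σ₀ ∈ Aut(K/ℚ)`, a class
`m ∈ H¹(K, E_K[2])` is a `σ₀`-invariant `2`-Selmer class of `E_K` iff it is the restriction of a class of the ∞-relaxed `2`-Selmer group of `W`
(the proof of file 50 §209 verbatim, its two descent-admissible inputs replaced by §V1). [cite: Kramer1981, Thm. 1 (proof)] [cite: GrossLMS1991, §5 (5.1)] -/
theorem mem_selmerGroup_and_conjAct_eq_iff_exists_mem_relaxed_of_descAdmissible_or_unram (hT : NoRationalTwoTorsion W) {d : ℤ}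
    (hd : DescAdmissible W d ∨ DescAdmissibleUnram W d) (h2 : Module.finrank ℚ K = 2) {i : K} (hi : i ^ 2 = (d : K))
    {σ₀ : K ≃ₐ[ℚ] K} (hσ₀ : σ₀ ≠ 1) (m : galH1Torsion (W.baseChange K) ((2 : ℕ) : ℤ)) :
    (m ∈ (W.baseChange K).selmerGroup ((2 : ℕ) : ℤ) ∧ conjAct W σ₀ ((2 : ℕ) : ℤ) m = m) ↔
      ∃ x ∈ selmerGroupRelaxedAtInfinityAtTwo W, resTorsion W K ((2 : ℕ) : ℤ) x = m := by
  haveI : IsGalois ℚ K := isGalois_of_finrank_eq_two K h2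
  have hdneg : d < 0 := neg_of_descAdmissible_or_unram W hd
  have hθ : i ∉ Set.range (algebraMap ℚ K) := by
    rintro ⟨q, hq⟩
    have hq2 : algebraMap ℚ K (q ^ 2) = algebraMap ℚ K (d : ℚ) := by rw [map_pow, hq, hi, map_intCast]
    have hq2' : q ^ 2 = (d : ℚ) := (algebraMap ℚ K).injective hq2
    have hd' : (d : ℚ) < 0 := by exact_mod_cast hdneg
    nlinarith [sq_nonneg q]
  have hc' : i ^ 2 = algebraMap ℚ K (d : ℚ) := by rw [hi, map_intCast]
  have h2t' : ∀ P : (W.baseChange K).toAffine.Point, ((2 : ℕ) : ℤ) • P = 0 → P = 0 := fun P hP ↦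
    Summit.BirchSwinnertonDyer.Rank1Residual.F1Sign2.EggDoubling.eq_zero_of_two_smul_eq_zero_baseChange W hT h2 P
      (by rwa [natCast_zsmul] at hP)
  constructor
  · rintro ⟨hm, hσm⟩
    have hall : ∀ σ : K ≃ₐ[ℚ] K, conjAct W σ ((2 : ℕ) : ℤ) m = m :=
      (RelModel.forall_conjAct_eq_iff_of_finrank_eq_two K W ((2 : ℕ) : ℤ) σ₀ h2 hσ₀ m).mpr hσm
    obtain ⟨x, hx⟩ := (GenusExact.EigenClassesFinite.mem_range_resTorsion_iff_conjAct_eq W K h2 hθ hc' _ h2t' m).mpr (hall _)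
    refine ⟨x, mem_selmerGroupRelaxedAtInfinityAtTwo_of_resTorsion_mem_selmerGroup_of_descAdmissible_or_unram W K hd h2 hi ?_, hx⟩
    rw [hx]
    exact hm
  · rintro ⟨x, hx, rfl⟩
    exact ⟨(resTorsion_mem_selmerGroup_iff_mem_selmerGroupRelaxedAtInfinityAtTwo_of_descAdmissible_or_unram W K hd h2 hi x).mpr hx,
      conjAct_resTorsion K W _ σ₀ h2 hσ₀ x⟩

/-- **`#Sel₂(E_K/K)^{σ₀} = #Sel₂^{rel ∞}(E)`, CLASS-FREE**: `x ↦ res_K x` is a bijection from the ∞-relaxed `2`-Selmer group of `E` onto the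
`σ₀`-fixed `2`-Selmer classes of `E_K` (§V2; injective by `GenusExact.EigenClassesFinite.resTorsion_injective_of_noTorsion`, `E(K)[2] = 0` from
`E(ℚ)[2] = 0`).  [cite: Kramer1981, Thm. 1 (proof)] [cite: GrossLMS1991, §5 (5.1)] -/
theorem natCard_fixedSelmer_eq_natCard_relaxed_of_descAdmissible_or_unram (hT : NoRationalTwoTorsion W) {d : ℤ}
    (hd : DescAdmissible W d ∨ DescAdmissibleUnram W d) (h2 : Module.finrank ℚ K = 2) {i : K} (hi : i ^ 2 = (d : K))
    (hir : i ∉ Set.range (algebraMap ℚ K)) {σ₀ : K ≃ₐ[ℚ] K} (hσ₀ : σ₀ ≠ 1) :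
    Nat.card {m : galH1Torsion (W.baseChange K) ((2 : ℕ) : ℤ) //
        m ∈ selmerGroup (W.baseChange K) ((2 : ℕ) : ℤ) ∧ conjAct W σ₀ ((2 : ℕ) : ℤ) m = m} =
      Nat.card (selmerGroupRelaxedAtInfinityAtTwo W) := by
  have hc : i ^ 2 = algebraMap ℚ K (d : ℚ) := by rw [hi, map_intCast]
  have hL : ∀ P : (W.baseChange K).toAffine.Point, ((2 : ℕ) : ℤ) • P = 0 → P = 0 := fun P hP ↦
    Summit.BirchSwinnertonDyer.Rank1Residual.F1Sign2.EggDoubling.eq_zero_of_two_smul_eq_zero_baseChange W hT h2 P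
      (by rwa [natCast_zsmul] at hP)
  have hinj := GenusExact.EigenClassesFinite.resTorsion_injective_of_noTorsion W K h2 hir hc ((2 : ℕ) : ℤ) hL
  symm
  refine Nat.card_congr (Equiv.ofBijective
    (fun x : selmerGroupRelaxedAtInfinityAtTwo W ↦
      (⟨resTorsion W K ((2 : ℕ) : ℤ) x.1,
        (mem_selmerGroup_and_conjAct_eq_iff_exists_mem_relaxed_of_descAdmissible_or_unram W K hT hd h2 hi hσ₀ _).mpr
          ⟨x.1, x.2, rfl⟩⟩ :
        {m : galH1Torsion (W.baseChange K) ((2 : ℕ) : ℤ) //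
          m ∈ selmerGroup (W.baseChange K) ((2 : ℕ) : ℤ) ∧ conjAct W σ₀ ((2 : ℕ) : ℤ) m = m}))
    ⟨fun x y hxy ↦ Subtype.ext (hinj (congrArg Subtype.val hxy)), fun m ↦ ?_⟩)
  obtain ⟨x, hx, hxm⟩ :=
    (mem_selmerGroup_and_conjAct_eq_iff_exists_mem_relaxed_of_descAdmissible_or_unram W K hT hd h2 hi hσ₀ m.1).mp m.2
  exact ⟨⟨x, hx⟩, Subtype.ext hxm⟩

end Summit.BirchSwinnertonDyer.BirchSwinnertonDyer.Theorems.GenusKolyArch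

end
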